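import Summits.SmoothPoincare4.SmoothPoincare4.Theorems.SymplecticOrigamiGromovRecognitionRelEndGlueDefs
import Summits.SmoothPoincare4.SmoothPoincare4.Theorems.SymplecticOrigamiGromovRecognitionRelEndLeafChart
import Summits.SmoothPoincare4.SmoothPoincare4.Theorems.SymplecticOrigamiGromovRecognitionRelEndFoliationCoordinate
import Literature.Geometry.Symplectic.JSphereLocalFoliation
import Literature.Geometry.Symplectic.AdjunctionEmbeddedSpheres

/-!
# The foliation coordinate of a leaf is a normal witness with `JX`-invariant kernels
(registered helper `helper_leafCoordinate` of line `cross-cap-laurent`, crux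
`GromovRecognitionRelEnd`, item stmt-SmoothPoincare4-11009; joint-step lemma J11 of the glue of
the bi-foliation)

Setting: `(X, JX)` a compact connected almost complex 4-manifold, `F₀ : C(ℂℙ¹, X)` a reference glued
map, the local foliation fact `hls_localFoliation_embeddedSphere_trivialNormal` (F1) and the
adjunction fact `adjunction_embedded_of_somewhereInjective_sphere` (F4) as HYPOTHESES, and a LEAF
`(u, v)` of the family of `F₀`.  Claim (`helper_leafCoordinate`): `(u, v)` has a
trivial-normal-bundle witness `(N, π)` whose kernels `ker dπ_y` are `JX`-invariant at EVERY point
`y ∈ N` (not only on the leaf).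

Proof.  Around the leaf, `helper_leaf_chart` (F1, F4) gives a jointly smooth family of LEAVES
`(U a, V a)`, `‖a‖ < ε`, through `(U 0, V 0) = (u, v)`, pairwise disjoint, with injective
differentials, sweeping out the open set `N = ⋃ ‖a‖ < ε, (range (U a) ∪ {V a 0})`.  Its leaf
parameter `π` (`helper_foliationCoordinate`) is smooth and submersive on `N`, its level sets in `N`
are the leaves — so `{y ∈ N | π y = 0} = range u ∪ {v 0}` and `(N, π)` is a normal witness of
`(u, v)` — and `ker dπ` at `U a z` (resp. `V a w`) is the range of `d(U a)_z` (resp. `d(V a)_w`).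
These ranges are `JX`-invariant because every member is a `JX`-holomorphic curve:
`JX (d(U a)_z ζ) = d(U a)_z (i ζ)`.

References: C. Wendl, *Holomorphic Curves in Low Dimensions*, LNM 2216 (2018), Prop. 2.53;
H. Hofer, V. Lizan, J.-C. Sikorav, J. Geom. Anal. 7 (1997), Thm. 1.  No new definitions, notation
or instances.
-/

noncomputable section

open scoped Manifold ContDiff Topology
open Set Function Filter Literature.Topology.FourManifolds Literature.Topology.FourManifolds.ComplexProjectiveSpace
  Literature.Geometry.Symplectic

-- the prescribed namespace `Summit.<P>.<Sub>.…` duplicates `SmoothPoincare4` (P = Sub)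
set_option linter.dupNamespace false

namespace Summit.SmoothPoincare4.SmoothPoincare4.Theorems.GromovRecognitionRelEnd.CrossCapLaurent

/-- **J11 (registered helper `helper_leafCoordinate`): the FOLIATION COORDINATE of a leaf is a
normal witness with `JX`-invariant kernels on its whole (open) domain.**  The local foliation by
leaves around `(u, v)` (`helper_leaf_chart`, using the facts F1 and F4 given as hypotheses) has a
smooth submersive leaf parameter `π` on the open union `N` of its leaves
(`helper_foliationCoordinate`), with `{y ∈ N | π y = 0} = range u ∪ {v 0}` and
`ker dπ_y = ` the tangent line of the leaf through `y`, which is `JX`-invariant since the leaves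
are `JX`-holomorphic curves. -/
theorem helper_leafCoordinate : ∀ (X : Type) [TopologicalSpace X] [T2Space X]
    [SecondCountableTopology X] [CompactSpace X] [ConnectedSpace X]
    [ChartedSpace (EuclideanSpace ℝ (Fin 4)) X] [IsManifold (𝓡 4) ∞ X]
    (JX : AlmostComplexStructure (𝓡 4) ∞ X) (F₀ : C(ComplexProjectiveSpace 1, X)),
    hls_localFoliation_embeddedSphere_trivialNormal →
    adjunction_embedded_of_somewhereInjective_sphere →
    ∀ (u v : ℂ → X), IsLeafOf (fun y => JX y) F₀ u v →
    ∃ (N : Set X) (π : X → ℂ), IsNormalWitness N π u v ∧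
      ∀ y ∈ N, ∀ ξ : TangentSpace (𝓡 4) y, mfderiv (𝓡 4) 𝓘(ℝ, ℂ) π y ξ = 0 →
        mfderiv (𝓡 4) 𝓘(ℝ, ℂ) π y (JX y ξ) = 0 := by
  intro X _ _ _ _ _ _ _ JX F₀ hF1 hF4 u v h
  -- the local foliation by leaves around `(u, v)`
  obtain ⟨ε, U, V, hε, hU0, hV0, hleaf, hUs, hVs, hdisj, hinj, hopen⟩ :=
    helper_leaf_chart X JX F₀ hF1 hF4 u v h
  -- the per-leaf hypothesis of the foliation coordinate, read off `IsLeafOf`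
  have hper : ∀ a : ℂ, ‖a‖ < ε →
      ContMDiff 𝓘(ℝ, ℂ) (𝓡 4) ∞ (U a) ∧ ContMDiff 𝓘(ℝ, ℂ) (𝓡 4) ∞ (V a) ∧
      (∀ z : ℂ, z ≠ 0 → V a z = U a z⁻¹) ∧
      Injective (U a) ∧ (∀ z, Injective (mfderiv 𝓘(ℝ, ℂ) (𝓡 4) (U a) z)) ∧
      Injective (mfderiv 𝓘(ℝ, ℂ) (𝓡 4) (V a) 0) ∧ V a 0 ∉ range (U a) := fun a ha =>
    ⟨(hleaf a ha).sphere.smooth_u, (hleaf a ha).sphere.smooth_v, (hleaf a ha).sphere.compat,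
      (hleaf a ha).embedded.injective, (hleaf a ha).embedded.imm_u, (hleaf a ha).embedded.imm_v,
      (hleaf a ha).embedded.infty_notMem⟩
  -- the leaf parameter `π`
  obtain ⟨π, hπs, hπsub, -, -, hlevel, hkerU, hkerV⟩ :=
    helper_foliationCoordinate X ε U V hε hper hUs hVs hdisj hinj hopen
  have hε0 : ‖(0 : ℂ)‖ < ε := by simpa using hε
  have hu : U 0 = u := funext hU0
  have hv0 : V 0 0 = v 0 := hV0 0
  refine ⟨⋃ a ∈ Metric.ball (0 : ℂ) ε, (range (U a) ∪ {V a 0}), π, ⟨hopen, ?_, hπs, hπsub, ?_⟩, ?_⟩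
  · -- the image `range u ∪ {v 0} = range (U 0) ∪ {V 0 0}` is the leaf `a = 0`
    rw [← hu, ← hv0]
    exact fun y hy => mem_iUnion₂.mpr ⟨0, Metric.mem_ball_self hε, hy⟩
  · -- the zero set of `π` in `N` is the leaf `a = 0`
    rw [← hu, ← hv0]
    exact hlevel 0 hε0
  · -- `JX`-invariance of the kernels: `ker dπ_y` is the tangent line of the `JX`-curve through `y`
    intro y hy ξ hξ
    rw [mem_iUnion₂] at hy
    obtain ⟨a, ha, hy⟩ := hy
    have ha' : ‖a‖ < ε := mem_ball_zero_iff.mp ha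
    rcases hy with ⟨z, rfl⟩ | hy
    · obtain ⟨ζ, rfl⟩ := (hkerU a ha' z ξ).mp hξ
      exact (hkerU a ha' z _).mpr ⟨(Complex.I * (show ℂ from ζ) : ℂ), (hleaf a ha').sphere.hol_u z ζ⟩
    · rw [mem_singleton_iff] at hy
      subst hy
      obtain ⟨ζ, rfl⟩ := (hkerV a ha' 0 ξ).mp hξ
      exact (hkerV a ha' 0 _).mpr ⟨(Complex.I * (show ℂ from ζ) : ℂ), (hleaf a ha').sphere.hol_v 0 ζ⟩

end Summit.SmoothPoincare4.SmoothPoincare4.Theorems.GromovRecognitionRelEnd.CrossCapLaurent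

end
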